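import Literature.AlgebraicGeometry.Motives.HodgeLieBlockSummandSurjective
import Literature.AlgebraicGeometry.Motives.HodgeStructureHodgeVectorBlockHodgeLieCentre
import HarnessLib

/-!
# The Hodge group of a block-diagonal direct summand EXTENDS BY THE IDENTITY: on `ℚ`-points,
# `w ∈ Hg(H₂)(ℚ) ⟹ ι w π + (1 − ι π) ∈ Hg(H)(ℚ)` when `𝔥(H)` is block diagonal for `e = ι π`; in particular
# `Hg(V₀ ⊕ V₀^⊥)(ℚ) = 1 × Hg(V₀^⊥)(ℚ)` for the Hodge-vector block `V₀ = V ∩ V^{m,m}`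
# (Moonen–Zarhin 1999 §3 «`Hg(X × Tate) = Hg(X)`»; Moonen 1999 (1.13); Deligne LNM 900 I Prop. 3.4)

[topic AlgebraicGeometry/Motives]

Layer `Literature/AlgebraicGeometry/Motives`. THEOREMS ONLY (no definition, no named fact, no instance, no notation).
Written for the cell `hodge-nonav` (prover seat `hodge-nonav-prover-Bx` g20; programme M2 = stub S2 of crux K1Q,
route `Q8SymplecticPowers`), but route-agnostic: it is the GROUP-LEVEL companion, on RATIONAL points of the tree's
tensor-stabiliser Hodge group `Hg(H) = H.hodgeGroup` (`Motives/HodgeTensor`), of the Lie-algebra statement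
`ι 𝔥(H₂) π ⊆ 𝔥(H)` of `Motives/HodgeLieBlockSummandSurjective` (`comp_mem_hodgeLie_of_block`), and it supplies the
direction missing from the tree's injective restriction `Hg(V)(K) ↪ Hg(V₀^⊥)(K)`
(`Motives/HodgeStructureHodgeVectorBlockHodgeGroupPoints`): the restriction is ONTO on `ℚ`-points.

## The sources, verbatim

* B. Moonen, Yu. G. Zarhin, *Hodge classes on abelian varieties of low dimension*, Math. Ann. 315 (1999), §3 (first
  paragraph): «the projections `Hg(X₁ × X₂) → Hg(Xᵢ)` are surjective», and «`Hg(X × (Tate)) = Hg(X)`» as used there.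
* B. Moonen, *Notes on Mumford–Tate groups* (1999), (1.13): «Let `V₁` and `V₂` be `ℚ`-HS. Write `V := V₁ ⊕ V₂`. It
  readily follows from the definitions that `Hg(V) ⊆ Hg(V₁) × Hg(V₂)` and that the two projections `Hg(V) → Hg(Vᵢ)`
  are surjective.»
* P. Deligne, *Hodge cycles on abelian varieties*, LNM 900 (1982), I §3.1 (the tensor spaces `T^{a,b}` and the action
  of `GL(V)`) and Prop. 3.4 (the Hodge group is the stabiliser of the Hodge tensors).
* M. Green, P. Griffiths, M. Kerr, *Mumford–Tate Groups and Domains* (2012), §I.B (I.B.1) Step one p. 36 and Ch. V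
  Warning p. 154 (splitting off the sub-Hodge structure of pure type `(n/2, n/2)`).

## The mechanism (group version of the proof in `Motives/HodgeLieBlockSummandSurjective`)

Let `ι : H₂ → H`, `π : H → H₂` be morphisms with `π ι = id`, `e = ι π`, and let `g ∈ GL(V)` act as `w ∈ GL(V₂)` on the
summand (`g ι = ι w`, `π g = w π`) and as the identity on `ker π` (`g (v − ιπv) = v − ιπv`). For a Hodge tensor `t` of
`H` in `T^{a,b}` put `s = ρ(g) t − t`. By `eq_zero_of_forall_tensorPairing_piecewise_eq_zero` it suffices that
`⟨J z, ρ(g) t⟩ = ⟨J z, t⟩` for every block insertion `J : T^{b',a'}(V₂) → T^{b,a}(V)` whose fixed letters lie in `ker π`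
(resp. vanish on `ι(V₂)`) (`Motives/TensorSpaceBlockInsertion`). GROUP naturality (§1): `ρ(g) ∘ J = J ∘ ρ(w)` — the
fixed letters are FIXED by `g`, the inserted ones are moved by `w` — and invariance of the contraction pairing give
`⟨J z, ρ(g) t⟩ = ⟨J(ρ(w⁻¹) z), t⟩ = ⟨ρ(w) t₂, z⟩` for the tensor `t₂ ∈ T^{a',b'}(V₂)` representing `z ↦ ⟨J z, t⟩`. As in
the Lie-algebra file, `t₂` is killed by `π 𝔥(H) ι` (because `e X ∈ 𝔥(H)` kills `t` for `X ∈ 𝔥(H)` — the block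
hypothesis), and the complex span of `π 𝔥(H) ι` contains an infinitesimal Hodge operator `Θ₂` of `H₂`
(`exists_theta_mem_span_restrict`); §2 (the tree's §1 of the Lie file, with its Hodge-class conclusion exposed) shows
that such a rational tensor is a Hodge class of `H₂` of type `(p,p)`, `2p = (a'−b')n` (or `0`), hence FIXED by
`w ∈ Hg(H₂)(ℚ)`: `⟨J z, ρ(g) t⟩ = ⟨t₂, z⟩ = ⟨J z, t⟩`.

For the Hodge-vector block `V = V₀ ⊕ V₀^⊥`, `V₀ = Hdgᵐ(H)`, `m + m = n`, of a polarizable `H`, the block hypothesis is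
the tree's `Polarization.subtype_comp_projectionOnto_comp_eq_of_mem_hodgeLie` (`(ιπ) X = X` for `X ∈ 𝔥(V)`), so
EVERY `w ∈ Hg(V₀^⊥)(ℚ)` extends: `1 ⊕ w ∈ Hg(V)(ℚ)` (§4).

## What is proved

* §1 `tensorSpaceActOver_blockInsertion` — group naturality of block insertions (any field `K`).
* §2 `exists_mem_hodgeClasses_or_eq_zero_of_forall_of_theta_mem_span` (a rational tensor of `V₂` killed by a
  `ℚ`-subspace `𝔤 ⊆ End V₂` with `Θ₂ ∈ 𝔤_ℂ` is a Hodge class of type `(p,p)`, `(a−b)n = 2p`, or is `0`) and its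
  corollary `tensorSpaceAct_eq_self_of_forall_of_theta_mem_span` (it is fixed by `Hg(H₂)(ℚ)`).
* §3 **`mem_hodgeGroup_of_block`** — the extension theorem for a block-diagonal direct summand.
* §4 **`Polarization.mem_hodgeGroup_of_eq_orthogonal_hodgeClasses`** — the Hodge-vector block: an automorphism of `V`
  fixing `V₀` pointwise, preserving `V₀^⊥` and restricting there to an element of `Hg(V₀^⊥)(ℚ)` lies in `Hg(V)(ℚ)`.

Honest scope: linear algebra of the tree's tensor-stabiliser groups; nothing here concerns a variety.
-/

noncomputable section

open scoped TensorProduct PiTensorProduct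

namespace Literature.AlgebraicGeometry.Motives

universe u v

/-! ### §1 Group naturality of block insertions -/

section Naturality

variable {K : Type u} [Field K] {W : Type v} [AddCommGroup W] [Module K W]
  {W₂ : Type v} [AddCommGroup W₂] [Module K W₂]
  {ι : W₂ →ₗ[K] W} {π : W →ₗ[K] W₂} {a b a' b' : ℕ} {S : Finset (Fin b)} {T : Finset (Fin a)}
  {w₁ : Fin b → W} {ψ₁ : Fin a → Module.Dual K W} {eS : ↥S ≃ Fin b'} {eT : ↥T ≃ Fin a'}
  {J : hodgeTensorSpaceOver K W₂ b' a' →ₗ[K] hodgeTensorSpaceOver K W b a}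

/-- **Group naturality of block insertions**: if `γ ∈ GL(W)` restricts to `γ₂ ∈ GL(W₂)` on the summand
(`γ ι = ι γ₂`, `π γ = γ₂ π`) and FIXES the inserted constant letters (`γ w₁ᵢ = w₁ᵢ`, `ψ₁ⱼ ∘ γ = ψ₁ⱼ`), then
`ρ_{b,a}(γ) (J z) = J (ρ_{b',a'}(γ₂) z)` — the group form of `tensorDerivation_blockInsertion`.
[cite: Deligne1982HodgeCycles, I §3.1] -/
theorem tensorSpaceActOver_blockInsertion (γ : W ≃ₗ[K] W) (γ₂ : W₂ ≃ₗ[K] W₂)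
    (hγι : ∀ x, γ (ι x) = ι (γ₂ x)) (hγπ : ∀ v, π (γ v) = γ₂ (π v))
    (hw₁ : ∀ i, γ (w₁ i) = w₁ i) (hψ₁ : ∀ j, ψ₁ j ∘ₗ (γ : W →ₗ[K] W) = ψ₁ j)
    (hJ : ∀ (u : Fin b' → W₂) (υ : Fin a' → Module.Dual K W₂),
      J (PiTensorProduct.tprod K u ⊗ₜ[K] PiTensorProduct.tprod K υ) =
        (PiTensorProduct.tprod K fun i => if h : i ∈ S then ι (u (eS ⟨i, h⟩)) else w₁ i) ⊗ₜ[K]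
          PiTensorProduct.tprod K fun j => if h : j ∈ T then π.dualMap (υ (eT ⟨j, h⟩)) else ψ₁ j)
    (z : hodgeTensorSpaceOver K W₂ b' a') :
    tensorSpaceActOver γ (J z) = J (tensorSpaceActOver γ₂ z) := by
  classical
  -- `π γ⁻¹ = γ₂⁻¹ π` and `ψ₁ⱼ ∘ γ⁻¹ = ψ₁ⱼ`
  have hγπ' : ∀ x, π (γ.symm x) = γ₂.symm (π x) := fun x => by
    rw [LinearEquiv.eq_symm_apply, ← hγπ, LinearEquiv.apply_symm_apply]
  have hψ₁' : ∀ j, ψ₁ j ∘ₗ (γ.symm : W →ₗ[K] W) = ψ₁ j := fun j => by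
    refine LinearMap.ext fun x => ?_
    have h := LinearMap.congr_fun (hψ₁ j) (γ.symm x)
    simp only [LinearMap.comp_apply, LinearEquiv.coe_coe, LinearEquiv.apply_symm_apply] at h
    simp only [LinearMap.comp_apply, LinearEquiv.coe_coe]
    exact h.symm
  suffices h : (tensorSpaceActOver (a := b) (b := a) γ).toLinearMap ∘ₗ J =
      J ∘ₗ (tensorSpaceActOver (a := b') (b := a') γ₂).toLinearMap from LinearMap.congr_fun h z
  ext u υ
  simp only [LinearMap.compMultilinearMap_apply, TensorProduct.AlgebraTensorModule.curry_apply,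
    TensorProduct.curry_apply, LinearMap.coe_restrictScalars, LinearMap.comp_apply, LinearEquiv.coe_coe]
  rw [hJ, tensorSpaceActOver_tmul_tprod, tensorSpaceActOver_tmul_tprod, hJ]
  congr 1
  · congr 1
    funext i
    by_cases hi : i ∈ S
    · rw [dif_pos hi, dif_pos hi, hγι]
    · rw [dif_neg hi, dif_neg hi, hw₁]
  · congr 1
    funext j
    by_cases hj : j ∈ T
    · rw [dif_pos hj, dif_pos hj]
      refine LinearMap.ext fun x => ?_
      simp only [LinearMap.comp_apply, LinearMap.dualMap_apply, LinearEquiv.coe_coe, hγπ']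
    · rw [dif_neg hj, dif_neg hj, hψ₁']

end Naturality

namespace HodgeStructure

variable {V₂ : Type u} [AddCommGroup V₂] [Module ℚ V₂] [Module.Finite ℚ V₂]
  {V : Type u} [AddCommGroup V] [Module ℚ V] [Module.Finite ℚ V] [HodgeTensorFacts.{u, u}] {n : ℤ}

/-! ### §2 Rational tensors killed by a subspace containing `Θ₂` over `ℂ` are Hodge classes, hence `Hg(H₂)`-fixed -/

/-- **A rational tensor of `V₂` killed by a `ℚ`-subspace `𝔤 ⊆ End V₂` whose complex span contains an infinitesimal
Hodge operator `Θ₂` of `H₂` (acting on `V₂^{p,n-p}` by `2p − n`) is a Hodge class of type `(p,p)` with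
`(a − b) n = 2p`, or is `0`.**  In a graded basis `Θ₂` is diagonal on the tensor basis with eigenvalue
`2·deg − (a−b)n`, so a rational `u` with `ρ(Θ₂)(ι u) = 0` has only components of degree `p`, `2p = (a−b)n`: it lies in
`F^p` (Deligne, Hodge II, 1.1.12); if `(a−b)n` is odd, `u = 0`. (The tree's
`tensorDerivation_eq_zero_of_forall_of_theta_mem_span`, with the Hodge-class conclusion exposed.)
[cite: DeligneHodgeII1971, 1.1.12 and 1.2.5] [cite: Deligne1982HodgeCycles, I Prop. 3.4] -/
theorem exists_mem_hodgeClasses_or_eq_zero_of_forall_of_theta_mem_span (H₂ : HodgeStructure V₂ n)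
    {g : Set (Module.End ℚ V₂)} {Θ : Module.End ℂ (ℂ ⊗[ℚ] V₂)}
    (hΘg : Θ ∈ Submodule.span ℂ ((fun X : Module.End ℚ V₂ => X.baseChange ℂ) '' g))
    (hΘ : ∀ p, ∀ x ∈ H₂.piece p (n - p), Θ x = ((2 * p - n : ℤ) : ℂ) • x)
    {a b : ℕ} {u : hodgeTensorSpace V₂ a b} (hu : ∀ z ∈ g, tensorDerivation a b z u = 0) :
    (∃ p : ℤ, ((a : ℤ) - b) * n = 2 * p ∧ u ∈ (H₂.tensorSpace a b).hodgeClasses p) ∨ u = 0 := by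
  classical
  obtain ⟨S, deg, e, hF, hFc⟩ := exists_basis_F_eq_span H₂
  haveI : Fintype S := FiniteDimensional.fintypeBasisIndex e
  -- `Θ` kills `ι u`
  have hspan : ∀ Z ∈ Submodule.span ℂ ((fun X : Module.End ℚ V₂ => X.baseChange ℂ) '' g),
      tensorDerivation a b Z (tensorSpaceToBaseChange ℂ V₂ a b u) = 0 := by
    intro Z hZ
    induction hZ using Submodule.span_induction with
    | mem Z hZ =>
      obtain ⟨X, hX, rfl⟩ := hZ
      rw [tensorDerivation_baseChange_tensorSpaceToBaseChange, hu X hX, map_zero]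
    | zero => simp
    | add Z Z' _ _ hZ hZ' => rw [map_add, LinearMap.add_apply, hZ, hZ', add_zero]
    | smul c Z _ hZ => rw [map_smul, LinearMap.smul_apply, hZ, smul_zero]
  have hΘu := hspan Θ hΘg
  -- `Θ` is diagonal on the tensor basis, with eigenvalue `2·deg − (a−b)n`
  have hdiag : ∀ σ, Θ (e σ) = ((1 : ℂ) * ((2 * deg σ - n : ℤ) : ℂ)) • e σ := fun σ => by
    rw [one_mul]
    exact apply_basis_eq_of_forall_piece H₂ e hF hFc (f := fun d => ((2 * d - n : ℤ) : ℂ)) hΘ σ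
  have hEx : ∀ x, tensorDerivation a b Θ (hodgeTensorBasis e a b x) =
      ((2 * tensorDegree deg x - ((a : ℤ) - b) * n : ℤ) : ℂ) • hodgeTensorBasis e a b x := by
    intro x
    rw [tensorDerivation_hodgeTensorBasis' e hdiag x]
    congr 1
    rw [← Finset.mul_sum, ← Finset.mul_sum, ← mul_sub, tensorDegree_apply, one_mul]
    push_cast
    simp only [Finset.sum_sub_distrib, Finset.sum_const, Finset.card_univ, Fintype.card_fin, nsmul_eq_mul,
      ← Finset.mul_sum]
    ring
  -- coefficients: `c_x · (2·deg x − (a−b)n) = 0`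
  have hsum : tensorSpaceToBaseChange ℂ V₂ a b u =
      ∑ x, (hodgeTensorBasis e a b).repr (tensorSpaceToBaseChange ℂ V₂ a b u) x • hodgeTensorBasis e a b x :=
    ((hodgeTensorBasis e a b).sum_repr _).symm
  have hcoef : ∀ x, (hodgeTensorBasis e a b).repr (tensorSpaceToBaseChange ℂ V₂ a b u) x *
      ((2 * tensorDegree deg x - ((a : ℤ) - b) * n : ℤ) : ℂ) = 0 := by
    have h0 : tensorDerivation a b Θ (tensorSpaceToBaseChange ℂ V₂ a b u) =
        ∑ x, ((hodgeTensorBasis e a b).repr (tensorSpaceToBaseChange ℂ V₂ a b u) x *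
          ((2 * tensorDegree deg x - ((a : ℤ) - b) * n : ℤ) : ℂ)) • hodgeTensorBasis e a b x := by
      conv_lhs => rw [hsum]
      rw [map_sum]
      refine Finset.sum_congr rfl fun x _ => ?_
      rw [map_smul, hEx, smul_smul]
    have hrepr := (hodgeTensorBasis e a b).repr_sum_self
      (fun x => (hodgeTensorBasis e a b).repr (tensorSpaceToBaseChange ℂ V₂ a b u) x *
        ((2 * tensorDegree deg x - ((a : ℤ) - b) * n : ℤ) : ℂ))
    rw [← h0, hΘu, map_zero] at hrepr
    intro x
    have hx := congrFun hrepr x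
    rw [Finsupp.coe_zero, Pi.zero_apply] at hx
    exact hx.symm
  have hsupp : ∀ x, (hodgeTensorBasis e a b).repr (tensorSpaceToBaseChange ℂ V₂ a b u) x ≠ 0 →
      2 * tensorDegree deg x = ((a : ℤ) - b) * n := by
    intro x hx
    rcases mul_eq_zero.1 (hcoef x) with h | h
    · exact absurd h hx
    · have h' : (2 * tensorDegree deg x - ((a : ℤ) - b) * n : ℤ) = 0 := by exact_mod_cast h
      omega
  by_cases hab : ∃ p : ℤ, ((a : ℤ) - b) * n = 2 * p
  · obtain ⟨p, hp⟩ := hab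
    -- `ι u ∈ span {E x | p ≤ deg x}`, hence `1 ⊗ u ∈ F^p`, so `u` is a Hodge class of type `(p,p)`
    have hmem : tensorSpaceToBaseChange ℂ V₂ a b u ∈
        Submodule.span ℂ (hodgeTensorBasis e a b '' {x | p ≤ tensorDegree deg x}) := by
      rw [Module.Basis.mem_span_image]
      intro x hx
      have hx' : (hodgeTensorBasis e a b).repr (tensorSpaceToBaseChange ℂ V₂ a b u) x ≠ 0 := by
        simpa using hx
      have := hsupp x hx'
      change p ≤ tensorDegree deg x
      omega
    have hu' : u ∈ (H₂.tensorSpace a b).hodgeClasses p := by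
      rw [mem_hodgeClasses_iff, ofRat_apply, tensorSpace_F_eq_span H₂ e hF a b p,
        show ((1 : ℂ) ⊗ₜ[ℚ] u) = (hodgeTensorSpaceBaseChange V₂ a b).symm (tensorSpaceToBaseChange ℂ V₂ a b u) by
          rw [← hodgeTensorSpaceBaseChange_one_tmul, LinearEquiv.symm_apply_apply]]
      have h := Submodule.mem_map_of_mem (f := (hodgeTensorSpaceBaseChange V₂ a b).symm.toLinearMap) hmem
      rw [Submodule.map_span, ← Set.image_comp] at h
      have hfun : ((hodgeTensorSpaceBaseChange V₂ a b).symm.toLinearMap ∘ hodgeTensorBasis e a b) =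
          hodgeTensorBasisBC e a b := by
        funext x
        simp [hodgeTensorBasisBC]
      rw [hfun] at h
      exact h
    exact Or.inl ⟨p, hp, hu'⟩
  · -- `(a−b)n` odd: all coefficients vanish, `u = 0`
    have hzero : tensorSpaceToBaseChange ℂ V₂ a b u = 0 := by
      rw [hsum]
      refine Finset.sum_eq_zero fun x _ => ?_
      by_cases hx : (hodgeTensorBasis e a b).repr (tensorSpaceToBaseChange ℂ V₂ a b u) x = 0
      · rw [hx, zero_smul]
      · exact absurd ⟨tensorDegree deg x, (hsupp x hx).symm⟩ hab
    exact Or.inr (tensorSpaceToBaseChange_injective V₂ a b (by rw [hzero, map_zero]))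

/-- **Such a tensor is fixed by every `w ∈ Hg(H₂)(ℚ)`** (a Hodge class of type `(p,p)`, `(a−b)n = 2p`, is fixed by the
tensor stabiliser; `0` is fixed). [cite: Deligne1982HodgeCycles, I Prop. 3.4] [cite: DeligneHodgeII1971, 1.1.12] -/
theorem tensorSpaceAct_eq_self_of_forall_of_theta_mem_span (H₂ : HodgeStructure V₂ n)
    {g : Set (Module.End ℚ V₂)} {Θ : Module.End ℂ (ℂ ⊗[ℚ] V₂)}
    (hΘg : Θ ∈ Submodule.span ℂ ((fun X : Module.End ℚ V₂ => X.baseChange ℂ) '' g))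
    (hΘ : ∀ p, ∀ x ∈ H₂.piece p (n - p), Θ x = ((2 * p - n : ℤ) : ℂ) • x)
    {a b : ℕ} {u : hodgeTensorSpace V₂ a b} (hu : ∀ z ∈ g, tensorDerivation a b z u = 0)
    {w : V₂ ≃ₗ[ℚ] V₂} (hw : w ∈ H₂.hodgeGroup) : tensorSpaceAct w u = u := by
  rcases exists_mem_hodgeClasses_or_eq_zero_of_forall_of_theta_mem_span H₂ hΘg hΘ hu with ⟨p, hp, hu'⟩ | rfl
  · exact (mem_hodgeGroup_iff H₂ w).1 hw a b p hp u hu'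
  · exact map_zero _

/-! ### §3 The Hodge group of a block-diagonal direct summand extends by the identity -/

variable {H₂ : HodgeStructure V₂ n} {H : HodgeStructure V n}

/-- **Extension by the identity: `g ∈ Hg(H)(ℚ)` for `g = ι w π ⊕ 1_{ker π}` with `w ∈ Hg(H₂)(ℚ)`, when `𝔥(H)` is block
diagonal for `e = ι π`.**  For a retract `ι : H₂ → H`, `π : H → H₂`, `π ι = id`, of pure `ℚ`-Hodge structures with
`e X ∈ 𝔥(H)` for all `X ∈ 𝔥(H)`, every `ℚ`-linear automorphism `g` of `V` which restricts to `w ∈ Hg(H₂)(ℚ)` on the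
summand (`g ι = ι w`, `π g = w π`) and is the identity on the complement `ker π` fixes every Hodge tensor of `H`
(module docstring: block insertions, group naturality, the representing tensor `t₂` is a Hodge class of `H₂`). This is
the surjectivity on `ℚ`-points of Moonen's restriction `Hg(H) → Hg(H₂)` for a direct summand whose Hodge Lie algebra
splits off («the projections `Hg(X₁ × X₂) → Hg(Xᵢ)` are surjective»). [cite: MoonenZarhin1999LowDim, §3]
[cite: Moonen1999MTNotes, (1.13)] [cite: Deligne1982HodgeCycles, I §3.1 and Prop. 3.4] -/
theorem mem_hodgeGroup_of_block (ι : Hom H₂ H) (π : Hom H H₂)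
    (hπι : ∀ v, π.toLinearMap (ι.toLinearMap v) = v)
    (hblock : ∀ X ∈ H.hodgeLie, (ι.toLinearMap ∘ₗ π.toLinearMap) ∘ₗ X ∈ H.hodgeLie)
    {w : V₂ ≃ₗ[ℚ] V₂} (hw : w ∈ H₂.hodgeGroup) {g : V ≃ₗ[ℚ] V}
    (hgι : ∀ x, g (ι.toLinearMap x) = ι.toLinearMap (w x))
    (hπg : ∀ v, π.toLinearMap (g v) = w (π.toLinearMap v))
    (hfix : ∀ v, g (v - ι.toLinearMap (π.toLinearMap v)) = v - ι.toLinearMap (π.toLinearMap v)) :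
    g ∈ H.hodgeGroup := by
  classical
  have hπιc : π.toLinearMap ∘ₗ ι.toLinearMap = LinearMap.id := LinearMap.ext hπι
  obtain ⟨Θ, hΘmem, hΘ⟩ := exists_theta_mem_span_restrict ι π hπι
  -- `X ∈ 𝔥(H)` commutes with `e = ι π`, so `ι (π X ι) π = e X ∈ 𝔥(H)`
  have he : ι.toLinearMap ∘ₗ π.toLinearMap ∈ H.endAlg := Hom.toLinearMap_mem_endAlg (ι.comp π)
  have hext : ∀ X ∈ H.hodgeLie,
      ι.toLinearMap ∘ₗ (π.toLinearMap ∘ₗ X ∘ₗ ι.toLinearMap) ∘ₗ π.toLinearMap ∈ H.hodgeLie := by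
    intro X hX
    have hXe : X * (ι.toLinearMap ∘ₗ π.toLinearMap) = (ι.toLinearMap ∘ₗ π.toLinearMap) * X :=
      commute_of_mem_hodgeLie H hX ⟨_, he⟩
    have heq : ι.toLinearMap ∘ₗ (π.toLinearMap ∘ₗ X ∘ₗ ι.toLinearMap) ∘ₗ π.toLinearMap =
        (ι.toLinearMap ∘ₗ π.toLinearMap) ∘ₗ X := by
      refine LinearMap.ext fun v => ?_
      have h3 := LinearMap.congr_fun hXe v
      simp only [Module.End.mul_apply, LinearMap.comp_apply] at h3
      simp only [LinearMap.comp_apply]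
      rw [h3, hπι]
    rw [heq]
    exact hblock X hX
  rw [mem_hodgeGroup_iff]
  intro a b p hab t ht
  -- it suffices that `s = ρ(g) t − t` pairs to zero with all adapted pure tensors
  rw [← sub_eq_zero]
  refine eq_zero_of_forall_tensorPairing_piecewise_eq_zero ι.toLinearMap π.toLinearMap _ fun S T w' ψ => ?_
  -- the block insertion of this pattern
  obtain ⟨J, hJ⟩ := exists_blockInsertion (K := ℚ) ι.toLinearMap π.toLinearMap S T
    (fun i => w' i - ι.toLinearMap (π.toLinearMap (w' i)))
    (fun j => ψ j - π.toLinearMap.dualMap (ι.toLinearMap.dualMap (ψ j))) S.equivFin T.equivFin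
  have hw₁ : ∀ i, π.toLinearMap (w' i - ι.toLinearMap (π.toLinearMap (w' i))) = 0 := fun i => by
    rw [map_sub, hπι, sub_self]
  have hψ₁ : ∀ j, (ψ j - π.toLinearMap.dualMap (ι.toLinearMap.dualMap (ψ j))) ∘ₗ ι.toLinearMap = 0 := fun j => by
    refine LinearMap.ext fun x => ?_
    simp [LinearMap.dualMap_apply, hπι]
  -- `g` fixes the complement letters and their duals
  have hgw₁ : ∀ i, g (w' i - ι.toLinearMap (π.toLinearMap (w' i))) = w' i - ι.toLinearMap (π.toLinearMap (w' i)) :=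
    fun i => hfix (w' i)
  have hgψ₁ : ∀ j, (ψ j - π.toLinearMap.dualMap (ι.toLinearMap.dualMap (ψ j))) ∘ₗ (g : V →ₗ[ℚ] V) =
      ψ j - π.toLinearMap.dualMap (ι.toLinearMap.dualMap (ψ j)) := fun j => by
    refine LinearMap.ext fun v => ?_
    -- `v = (v − ιπv) + ιπv`: on the first summand `g` is the identity, the second is killed on both sides
    have hsplit : g v = (v - ι.toLinearMap (π.toLinearMap v)) + ι.toLinearMap (w (π.toLinearMap v)) := by
      conv_lhs => rw [show v = (v - ι.toLinearMap (π.toLinearMap v)) + ι.toLinearMap (π.toLinearMap v) by abel]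
      rw [map_add, hfix, hgι]
    simp only [LinearMap.comp_apply, LinearEquiv.coe_coe, LinearMap.sub_apply, LinearMap.dualMap_apply, hsplit, map_add,
      hπι]
    have h1 : π.toLinearMap (v - ι.toLinearMap (π.toLinearMap v)) = 0 := by rw [map_sub, hπι, sub_self]
    rw [h1, map_zero, map_zero, sub_zero, map_sub]
    abel
  rw [← blockInsertion_apply_piecewise hJ]
  set z₀ : hodgeTensorSpaceOver ℚ V₂ S.card T.card :=
    (PiTensorProduct.tprod ℚ fun k => π.toLinearMap (w' ((S.equivFin.symm k : ↥S) : Fin b))) ⊗ₜ[ℚ]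
      PiTensorProduct.tprod ℚ fun k => ι.toLinearMap.dualMap (ψ ((T.equivFin.symm k : ↥T) : Fin a))
  -- the representing tensor `t₂ ∈ T^{a',b'}(V₂)` of `z ↦ ⟨J z, t⟩`
  obtain ⟨t₂, ht₂⟩ := exists_tensorPairing_eq (K := ℚ) (W := V₂)
    ((LinearMap.applyₗ t ∘ₗ tensorPairing a b) ∘ₗ J)
  have hlam : ∀ z, tensorPairing a b (J z) t = tensorPairing S.card T.card t₂ z := fun z => by
    have h := LinearMap.congr_fun ht₂ z
    simp only [LinearMap.comp_apply, LinearMap.applyₗ_apply_apply] at h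
    exact h.symm
  -- for a block operator `ι Y' π`: `⟨J z, ρ(ι Y' π) t⟩ = ⟨ρ(Y') t₂, z⟩`
  have hkey : ∀ (Y' : Module.End ℚ V₂) (z : hodgeTensorSpaceOver ℚ V₂ S.card T.card),
      tensorPairing a b (J z) (tensorDerivation a b (ι.toLinearMap ∘ₗ Y' ∘ₗ π.toLinearMap) t) =
        tensorPairing S.card T.card (tensorDerivation T.card S.card Y' t₂) z := by
    intro Y' z
    have hinv := tensorPairing_tensorDerivation_add (ι.toLinearMap ∘ₗ Y' ∘ₗ π.toLinearMap) (J z) t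
    have hinv₂ := tensorPairing_tensorDerivation_add Y' t₂ z
    rw [tensorDerivation_blockInsertion hπιc hw₁ hψ₁ hJ Y' z, hlam] at hinv
    linear_combination hinv - hinv₂
  -- `t₂` is killed by `π 𝔥(H) ι`
  have ht₂g : ∀ z' ∈ ((fun X : Module.End ℚ V => π.toLinearMap ∘ₗ X ∘ₗ ι.toLinearMap) ''
      (H.hodgeLie : Set (Module.End ℚ V))), tensorDerivation T.card S.card z' t₂ = 0 := by
    rintro _ ⟨X, hX, rfl⟩
    apply (tensorPairing_bijective (K := ℚ) (W := V₂) S.card T.card).1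
    rw [map_zero]
    refine LinearMap.ext fun z => ?_
    rw [LinearMap.zero_apply, ← hkey,
      (mem_hodgeLie_iff H _).1 (hext X hX) a b p hab t ht, map_zero]
  -- hence `t₂` is a Hodge class of `H₂` (or `0`), fixed by `w ∈ Hg(H₂)(ℚ)`
  have hwt₂ : tensorSpaceAct w t₂ = t₂ := tensorSpaceAct_eq_self_of_forall_of_theta_mem_span H₂ hΘmem hΘ ht₂g hw
  -- group naturality: `⟨J z₀, ρ(g) t⟩ = ⟨ρ(g⁻¹) (J z₀), t⟩ = ⟨J (ρ(w⁻¹) z₀), t⟩ = ⟨ρ(w) t₂, z₀⟩ = ⟨t₂, z₀⟩`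
  have hgι' : ∀ x, g⁻¹ (ι.toLinearMap x) = ι.toLinearMap (w⁻¹ x) := fun x => by
    rw [LinearEquiv.coe_inv, LinearEquiv.coe_inv, LinearEquiv.symm_apply_eq, hgι, LinearEquiv.apply_symm_apply]
  have hπg' : ∀ v, π.toLinearMap (g⁻¹ v) = w⁻¹ (π.toLinearMap v) := fun v => by
    rw [LinearEquiv.coe_inv, LinearEquiv.coe_inv, LinearEquiv.eq_symm_apply, ← hπg, LinearEquiv.apply_symm_apply]
  have hgw₁' : ∀ i, g⁻¹ (w' i - ι.toLinearMap (π.toLinearMap (w' i))) = w' i - ι.toLinearMap (π.toLinearMap (w' i)) :=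
    fun i => by
      rw [LinearEquiv.coe_inv, LinearEquiv.symm_apply_eq]
      exact (hgw₁ i).symm
  have hgψ₁' : ∀ j, (ψ j - π.toLinearMap.dualMap (ι.toLinearMap.dualMap (ψ j))) ∘ₗ ((g⁻¹ : V ≃ₗ[ℚ] V) : V →ₗ[ℚ] V) =
      ψ j - π.toLinearMap.dualMap (ι.toLinearMap.dualMap (ψ j)) := fun j => by
    refine LinearMap.ext fun v => ?_
    have h := LinearMap.congr_fun (hgψ₁ j) (g⁻¹ v)
    simp only [LinearMap.comp_apply, LinearEquiv.coe_coe, LinearEquiv.coe_inv, LinearEquiv.apply_symm_apply] at h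
    rw [LinearMap.comp_apply, LinearEquiv.coe_coe]
    exact h.symm
  have hnat : tensorSpaceActOver g⁻¹ (J z₀) = J (tensorSpaceActOver w⁻¹ z₀) :=
    tensorSpaceActOver_blockInsertion g⁻¹ w⁻¹ hgι' hπg' hgw₁' hgψ₁' hJ z₀
  rw [map_sub, ← tensorSpaceActOver_rat, tensorPairing_apply_tensorSpaceActOver, hnat, hlam, hlam,
    tensorPairing_apply_tensorSpaceActOver, inv_inv, tensorSpaceActOver_rat, hwt₂, sub_self]

/-! ### §4 The Hodge-vector block: `Hg(V₀ ⊕ V₀^⊥)(ℚ) = 1 × Hg(V₀^⊥)(ℚ)` -/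

/-- **«`Hg(X × Tate) = Hg(X)`» on `ℚ`-points, extension direction.**  Let `H` be a polarizable `ℚ`-Hodge structure of
weight `n = m + m` on `V`, `S = V₀ = Hdgᵐ(H)` the Hodge vectors and `T = V₀^⊥` (sub-Hodge structures, `V = V₀ ⊕ V₀^⊥`).
If `g ∈ GL(V)` fixes `V₀` pointwise, and restricts on `V₀^⊥` to `w ∈ Hg(V₀^⊥)(ℚ)` (`g t = w t` for `t ∈ V₀^⊥`), then
`g ∈ Hg(H)(ℚ)`. With the tree's injective restriction (`Polarization.hodgeRestrictHom_injective_of_eq_orthogonal`) this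
is the bijection `Hg(V)(ℚ) ≅ Hg(V₀^⊥)(ℚ)`. The block hypothesis of §3 is the tree's
`Polarization.subtype_comp_projectionOnto_comp_eq_of_mem_hodgeLie` (`𝔥(V)` has zero `V₀`-block).
[cite: MoonenZarhin1999LowDim, §3] [cite: Moonen1999MTNotes, (1.13)] [cite: GreenGriffithsKerr2012, Ch. V Warning p. 154] -/
theorem Polarization.mem_hodgeGroup_of_eq_orthogonal_hodgeClasses (ψ : Polarization H) {m : ℤ} (hm : m + m = n)
    {S T : SubHodgeStructure H} (hS : S.toSubmodule = H.hodgeClasses m)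
    (hT : T.toSubmodule = ψ.form.orthogonal (H.hodgeClasses m))
    {w : T.toSubmodule ≃ₗ[ℚ] T.toSubmodule} (hw : w ∈ T.toHodgeStructure.hodgeGroup) {g : V ≃ₗ[ℚ] V}
    (hgS : ∀ s ∈ S.toSubmodule, g s = s) (hgT : ∀ t : T.toSubmodule, g t = w t) : g ∈ H.hodgeGroup := by
  have hc := (ψ.isCompl_of_eq_hodgeClasses_of_eq_orthogonal hm hS hT).symm
  have hπι : ∀ v : T.toSubmodule, (T.projectionOntoHom S hc).toLinearMap (T.subtypeHom.toLinearMap v) = v := fun v => by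
    rw [SubHodgeStructure.subtypeHom_toLinearMap, SubHodgeStructure.projectionOntoHom_toLinearMap]
    exact Submodule.projectionOnto_apply_left hc v
  have hblock : ∀ X ∈ H.hodgeLie,
      (T.subtypeHom.toLinearMap ∘ₗ (T.projectionOntoHom S hc).toLinearMap) ∘ₗ X ∈ H.hodgeLie := by
    intro X hX
    rw [SubHodgeStructure.subtypeHom_toLinearMap, SubHodgeStructure.projectionOntoHom_toLinearMap,
      ψ.subtype_comp_projectionOnto_comp_eq_of_mem_hodgeLie hm hS hT hX]
    exact hX
  -- the complement `ker π = S` decomposition of a vector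
  have hdec : ∀ v : V, v - T.subtypeHom.toLinearMap ((T.projectionOntoHom S hc).toLinearMap v) ∈ S.toSubmodule := by
    intro v
    rw [SubHodgeStructure.subtypeHom_toLinearMap, SubHodgeStructure.projectionOntoHom_toLinearMap, Submodule.subtype_apply,
      Submodule.coe_projectionOnto_apply]
    exact Submodule.sub_projection_mem hc v
  refine mem_hodgeGroup_of_block T.subtypeHom (T.projectionOntoHom S hc) hπι hblock hw (g := g) ?_ ?_ ?_
  · intro x
    rw [SubHodgeStructure.subtypeHom_toLinearMap, Submodule.subtype_apply, Submodule.subtype_apply]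
    exact hgT x
  · intro v
    -- `π (g v) = π (g (v − ιπv) + g ιπv) = π (v − ιπv) + π ι (w πv) = w (π v)`
    have hv : g v = (v - T.subtypeHom.toLinearMap ((T.projectionOntoHom S hc).toLinearMap v)) +
        T.subtypeHom.toLinearMap (w ((T.projectionOntoHom S hc).toLinearMap v)) := by
      conv_lhs => rw [show v = (v - T.subtypeHom.toLinearMap ((T.projectionOntoHom S hc).toLinearMap v)) +
        T.subtypeHom.toLinearMap ((T.projectionOntoHom S hc).toLinearMap v) by abel]
      rw [map_add, hgS _ (hdec v), SubHodgeStructure.subtypeHom_toLinearMap, Submodule.subtype_apply, Submodule.subtype_apply,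
        hgT]
    rw [hv, map_add, hπι]
    have h0 : (T.projectionOntoHom S hc).toLinearMap
        (v - T.subtypeHom.toLinearMap ((T.projectionOntoHom S hc).toLinearMap v)) = 0 := by
      rw [SubHodgeStructure.projectionOntoHom_toLinearMap]
      exact Submodule.projectionOnto_apply_of_mem_right hc (hdec v)
    rw [h0, zero_add]
  · intro v
    exact hgS _ (hdec v)

end HodgeStructure

end Literature.AlgebraicGeometry.Motives

end
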